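import Summits.CriticalPhenomena.PercolationContinuityZ3.Theorems.PercNearOneGluingNoHeavyQuantReflectionHeavy
import Summits.CriticalPhenomena.PercolationContinuityZ3.Theorems.PercNearOneGluingNoHeavyQuantZeroLowHeavy
import Summits.CriticalPhenomena.PercolationContinuityZ3.Theorems.PercNearOneGluingNoHeavyQuantLightPairCornerWitness
import HarnessLib

/-!
# QUANT lane R8, T-DEC: THREE BLOBS WITH ARBITRARY GATES ARE HEAVY-DEC AT THEIR AVERAGE GATE — BLOB-AFL(3) for every gate vector,
# by the two uniform certificates (zero-only-low for `Σg ≤ 2`, reflection for `Σg > 2`) and one Schur inequality (prim-quant-census-2 gen 81)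

builds on p205010 (kernel theorem, internal audit signed; external expert review pending)

Support file (`--supports stmt-CriticalPhenomena-4575`), QUANT lane census seat prim-quant-census-2 (gen 81); memo
`run/shared/lean/prim/quant/prim-quant-census-2-g81/AFL-G81.md` §3.6 / §5.  Theorems only, standard axioms, no sorries, no definitions.

The kernel's three-blob lemma `heavy_threeBlobs` (census-2 g80, `…QuantBlobAverageFloor`) has gates `(g, g, cg)`.  Here the gates are arbitrary:
for `g₁, g₂, g₃ ∈ [0,1]` with `0 < s := g₁+g₂+g₃ < 3` and a blob size `k ≥ 1`, the law `blobLaw [(k,g₁),(k,g₂),(k,g₃)]` of `k·(ξ₁+ξ₂+ξ₃)` is an exact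
mixture of two-point components `{lo, hi; γ}` with `γ ≥ s/3` (the AVERAGE gate) and credit `2lo + (hi−lo)γ ≥ s·k` (its mean) — **`heavy_threeBlobs_gates`**.
Proof: for `s ≤ 2` the only low atom is `0` (`heavy_blobLaw_of_mean_le_two`, `…QuantZeroLowHeavy`); for `s > 2` the reflection certificate
`0 ↔ 3k`, `k ↔ 2k` at the floor gate (`heavy_of_reflection`, `…QuantReflectionHeavy`), whose two capacities are, in `uᵢ = 1 − gᵢ` (`U = Σuᵢ = 3 − s ≤ 1`):
* `threeGates_capacity_zero`: `s·p₀ ≤ (3−s)·p₃` ⟺ `U(1−U) + Σ_{i≠j} uᵢ²uⱼ ≥ 0`;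
* `threeGates_capacity_one`: `s·p₁ ≤ (3−s)·p₂` ⟺ `Schur(u) + (1−U)·(Σuᵢ² − Σ_{i<j}uᵢuⱼ) ≥ 0`, `Schur(u) = Σ u(u−v)(u−w) ≥ 0` (`schur_cubic`) — EQUALITY on the
  whole diagonal `g₁ = g₂ = g₃` (the average gate is sharp for the pair `k ↔ 2k` of equal blobs).
Also `blobLaw_three_apply` (the four atoms `p₀..p₃` as symmetric polynomials) and `decAtT_threeBlobs_gates` (DEC at every layer).
Census (guidance, memo §3.6): both capacities have margin `≥ 0` on 200 000 random + 61³ grid gate vectors with `s > 2` (min margins `0` at `(1,1,1)` and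
`−1e−16` on the diagonal).

HONEST STATUS.  BLOB-AFL for `n ≥ 4` arbitrary gates, and for `n ≥ 5` even with gates `(g,…,g,cg)`, is open in the middle band (memo §3.5); `SiblingStep`,
`FarTreeRow` OPEN; RATE class (log\*) / honest sentence of `run/shared/lean/prim/quant/README.md` unchanged.  [this work].  Schur's inequality is classical
[folklore]; nothing here is cited as a published result.  The gluing rows served [cite: KozmaNitzan2024, Conjecture 3 (p. 15)]; product measure
[cite: Grimmett1999, §1.3 p. 10].
-/

noncomputable section

open scoped BigOperators

namespace Summit.CriticalPhenomena.PercolationContinuityZ3.Theorems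
namespace Quant

open Finset

/-- the two-point law `{lo, hi; g}` (as in `…QuantLawDEC`) -/
local notation3 "TP[" lo ", " hi ", " g ", " h "]" =>
  (g : ℝ) * (if (h : ℕ) = (hi : ℕ) then (1 : ℝ) else 0) + (1 - (g : ℝ)) * (if (h : ℕ) = (lo : ℕ) then (1 : ℝ) else 0)

namespace LawDec

/-! ### Schur and the two reflection capacities -/

/-- **Schur's inequality, degree one**: `u(u−v)(u−w) + v(v−u)(v−w) + w(w−u)(w−v) ≥ 0` for `u, v, w ≥ 0` (when `w` is the least variable the sum is
`(u−v)²(u+v−w) + w(u−w)(v−w)`). [folklore] -/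
theorem schur_cubic {u v w : ℝ} (hu : 0 ≤ u) (hv : 0 ≤ v) (hw : 0 ≤ w) :
    0 ≤ u * (u - v) * (u - w) + v * (v - u) * (v - w) + w * (w - u) * (w - v) := by
  have key : ∀ a b c : ℝ, a * (a - b) * (a - c) + b * (b - a) * (b - c) + c * (c - a) * (c - b)
      = (a - b) ^ 2 * (a + b - c) + c * ((a - c) * (b - c)) := fun a b c => by ring
  rcases le_total w u with hwu | huw <;> rcases le_total w v with hwv | hvw
  · -- `w` least
    rw [key u v w]
    nlinarith [mul_nonneg (sq_nonneg (u - v)) (by linarith : 0 ≤ u + v - w), mul_nonneg hw (mul_nonneg (sub_nonneg.2 hwu) (sub_nonneg.2 hwv))]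
  · -- `v ≤ w ≤ u`: `v` least
    have e : u * (u - v) * (u - w) + v * (v - u) * (v - w) + w * (w - u) * (w - v)
        = (u - w) ^ 2 * (u + w - v) + v * ((u - v) * (w - v)) := by ring
    rw [e]
    nlinarith [mul_nonneg (sq_nonneg (u - w)) (by linarith : 0 ≤ u + w - v),
      mul_nonneg hv (mul_nonneg (sub_nonneg.2 (hvw.trans hwu)) (sub_nonneg.2 hvw))]
  · -- `u ≤ w ≤ v`: `u` least
    have e : u * (u - v) * (u - w) + v * (v - u) * (v - w) + w * (w - u) * (w - v)
        = (v - w) ^ 2 * (v + w - u) + u * ((v - u) * (w - u)) := by ring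
    rw [e]
    nlinarith [mul_nonneg (sq_nonneg (v - w)) (by linarith : 0 ≤ v + w - u),
      mul_nonneg hu (mul_nonneg (sub_nonneg.2 (huw.trans hwv)) (sub_nonneg.2 huw))]
  · -- `u, v ≤ w`: the least of `u, v`
    rcases le_total u v with huv | hvu
    · have e : u * (u - v) * (u - w) + v * (v - u) * (v - w) + w * (w - u) * (w - v)
          = (v - w) ^ 2 * (v + w - u) + u * ((v - u) * (w - u)) := by ring
      rw [e]
      nlinarith [mul_nonneg (sq_nonneg (v - w)) (by linarith : 0 ≤ v + w - u),
        mul_nonneg hu (mul_nonneg (sub_nonneg.2 huv) (sub_nonneg.2 huw))]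
    · have e : u * (u - v) * (u - w) + v * (v - u) * (v - w) + w * (w - u) * (w - v)
          = (u - w) ^ 2 * (u + w - v) + v * ((u - v) * (w - v)) := by ring
      rw [e]
      nlinarith [mul_nonneg (sq_nonneg (u - w)) (by linarith : 0 ≤ u + w - v),
        mul_nonneg hv (mul_nonneg (sub_nonneg.2 hvu) (sub_nonneg.2 hvw))]

/-- **reflection capacity of the zero atom** (`gᵢ ≤ 1`, `s ≥ 2`): `s·(1−g₁)(1−g₂)(1−g₃) ≤ (3−s)·g₁g₂g₃`.  In `uᵢ = 1−gᵢ`, `U = Σuᵢ ≤ 1`: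
`(3−U)·uvw ≤ U·Π(1−uᵢ)` ⟺ `U(1−U) + Σ_{i≠j} uᵢ²uⱼ ≥ 0`. [this work] -/
theorem threeGates_capacity_zero {g₁ g₂ g₃ : ℝ} (h₁1 : g₁ ≤ 1) (h₂1 : g₂ ≤ 1) (h₃1 : g₃ ≤ 1) (hs : 2 ≤ g₁ + g₂ + g₃) :
    (g₁ + g₂ + g₃) * ((1 - g₁) * (1 - g₂) * (1 - g₃)) ≤ (3 - (g₁ + g₂ + g₃)) * (g₁ * g₂ * g₃) := by
  -- `u, v, w ≥ 0`, `U = u + v + w ≤ 1`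
  have hu : 0 ≤ 1 - g₁ := by linarith
  have hv : 0 ≤ 1 - g₂ := by linarith
  have hw : 0 ≤ 1 - g₃ := by linarith
  have key : (3 - (g₁ + g₂ + g₃)) * (g₁ * g₂ * g₃) - (g₁ + g₂ + g₃) * ((1 - g₁) * (1 - g₂) * (1 - g₃))
      = ((1 - g₁) + (1 - g₂) + (1 - g₃)) * (1 - ((1 - g₁) + (1 - g₂) + (1 - g₃)))
        + ((1 - g₁) ^ 2 * (1 - g₂) + (1 - g₁) ^ 2 * (1 - g₃) + (1 - g₂) ^ 2 * (1 - g₁) + (1 - g₂) ^ 2 * (1 - g₃)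
          + (1 - g₃) ^ 2 * (1 - g₁) + (1 - g₃) ^ 2 * (1 - g₂)) := by ring
  nlinarith [mul_nonneg (by linarith : 0 ≤ (1 - g₁) + (1 - g₂) + (1 - g₃)) (by linarith : 0 ≤ 1 - ((1 - g₁) + (1 - g₂) + (1 - g₃))),
    mul_nonneg (sq_nonneg (1 - g₁)) hv, mul_nonneg (sq_nonneg (1 - g₁)) hw, mul_nonneg (sq_nonneg (1 - g₂)) hu,
    mul_nonneg (sq_nonneg (1 - g₂)) hw, mul_nonneg (sq_nonneg (1 - g₃)) hu, mul_nonneg (sq_nonneg (1 - g₃)) hv]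

/-- **reflection capacity of the atom `k`** (`s ≥ 2`): `s·p₁ ≤ (3−s)·p₂`, `p₁ = Σᵢ gᵢ Π_{j≠i}(1−gⱼ)`, `p₂ = Σᵢ (1−gᵢ) Π_{j≠i} gⱼ`.  In `uᵢ = 1−gᵢ`:
`(3−s)p₂ − s·p₁ = Schur(u) + (1−U)·½Σ_{i<j}(uᵢ−uⱼ)²` — equality iff `g₁ = g₂ = g₃`. [this work] -/
theorem threeGates_capacity_one {g₁ g₂ g₃ : ℝ} (h₁1 : g₁ ≤ 1) (h₂1 : g₂ ≤ 1) (h₃1 : g₃ ≤ 1) (hs : 2 ≤ g₁ + g₂ + g₃) :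
    (g₁ + g₂ + g₃) * (g₁ * (1 - g₂) * (1 - g₃) + (1 - g₁) * g₂ * (1 - g₃) + (1 - g₁) * (1 - g₂) * g₃)
      ≤ (3 - (g₁ + g₂ + g₃)) * (g₁ * g₂ * (1 - g₃) + g₁ * (1 - g₂) * g₃ + (1 - g₁) * g₂ * g₃) := by
  have hu : 0 ≤ 1 - g₁ := by linarith
  have hv : 0 ≤ 1 - g₂ := by linarith
  have hw : 0 ≤ 1 - g₃ := by linarith
  have hS := schur_cubic hu hv hw
  have key : (3 - (g₁ + g₂ + g₃)) * (g₁ * g₂ * (1 - g₃) + g₁ * (1 - g₂) * g₃ + (1 - g₁) * g₂ * g₃)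
        - (g₁ + g₂ + g₃) * (g₁ * (1 - g₂) * (1 - g₃) + (1 - g₁) * g₂ * (1 - g₃) + (1 - g₁) * (1 - g₂) * g₃)
      = ((1 - g₁) * ((1 - g₁) - (1 - g₂)) * ((1 - g₁) - (1 - g₃)) + (1 - g₂) * ((1 - g₂) - (1 - g₁)) * ((1 - g₂) - (1 - g₃))
          + (1 - g₃) * ((1 - g₃) - (1 - g₁)) * ((1 - g₃) - (1 - g₂)))
        + (1 - ((1 - g₁) + (1 - g₂) + (1 - g₃))) * ((g₁ - g₂) ^ 2 + (g₂ - g₃) ^ 2 + (g₃ - g₁) ^ 2) / 2 := by ring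
  nlinarith [mul_nonneg (by linarith : 0 ≤ 1 - ((1 - g₁) + (1 - g₂) + (1 - g₃)))
    (by positivity : 0 ≤ (g₁ - g₂) ^ 2 + (g₂ - g₃) ^ 2 + (g₃ - g₁) ^ 2)]

/-! ### The law of three blobs of a common size, atom by atom -/

/-- **three blobs `(k, g₁), (k, g₂), (k, g₃)` atom by atom**: `p₀ δ₀ + p₁ δ_k + p₂ δ_{2k} + p₃ δ_{3k}` with the elementary-symmetric weights. [this work] -/
theorem blobLaw_three_apply (k : ℕ) (g₁ g₂ g₃ : ℝ) (h : ℕ) :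
    blobLaw [(k, g₁), (k, g₂), (k, g₃)] h
      = (1 - g₁) * (1 - g₂) * (1 - g₃) * pointLaw 0 h
        + (g₁ * (1 - g₂) * (1 - g₃) + (1 - g₁) * g₂ * (1 - g₃) + (1 - g₁) * (1 - g₂) * g₃) * pointLaw k h
        + (g₁ * g₂ * (1 - g₃) + g₁ * (1 - g₂) * g₃ + (1 - g₁) * g₂ * g₃) * pointLaw (2 * k) h
        + g₁ * g₂ * g₃ * pointLaw (3 * k) h := by
  have e3 : blobLaw [(k, g₃)] = fun t => (1 - g₃) * pointLaw 0 t + g₃ * pointLaw k t := funext fun t => blobLaw_one_apply k g₃ t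
  have e2 : blobLaw [(k, g₂), (k, g₃)]
      = fun t => (1 - g₂) * (1 - g₃) * pointLaw 0 t + ((1 - g₂) * g₃ + g₂ * (1 - g₃)) * pointLaw k t + g₂ * g₃ * pointLaw (2 * k) t := by
    funext t
    show slice (blobLaw [(k, g₃)]) k g₂ t = _
    rw [e3, slice_apply_lin2, Nat.add_zero, show k + k = 2 * k by ring]
    ring
  show slice (blobLaw [(k, g₂), (k, g₃)]) k g₁ h = _
  rw [e2, slice_apply_lin3, Nat.add_zero, show k + k = 2 * k by ring, show k + 2 * k = 3 * k by ring]
  ring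

/-! ### BLOB-AFL(3) for arbitrary gates -/

/-- **THREE BLOBS WITH ARBITRARY GATES ARE HEAVY-DEC AT THEIR AVERAGE GATE.**  For a blob size `k ≥ 1` and gates `g₁, g₂, g₃ ∈ [0,1]` with
`0 < s = g₁+g₂+g₃ < 3`, the law of `k·(ξ₁+ξ₂+ξ₃)` on `{0..3k}` is an exact mixture of components `{lo, hi; γ}` with `γ ≥ s/3` and credit
`2·lo + (hi−lo)·γ ≥ s·k`: for `s ≤ 2` by `heavy_blobLaw_of_mean_le_two`, for `s > 2` by `heavy_of_reflection` (`0 ↔ 3k`, `k ↔ 2k` at gate `s/3`) with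
`threeGates_capacity_zero/one`.  Generalises `heavy_threeBlobs` (gates `(g,g,cg)`). [this work] -/
theorem heavy_threeBlobs_gates (k : ℕ) (hk : 0 < k) {g₁ g₂ g₃ : ℝ} (h₁0 : 0 ≤ g₁) (h₁1 : g₁ ≤ 1) (h₂0 : 0 ≤ g₂) (h₂1 : g₂ ≤ 1)
    (h₃0 : 0 ≤ g₃) (h₃1 : g₃ ≤ 1) (hs0 : 0 < g₁ + g₂ + g₃) (hs3 : g₁ + g₂ + g₃ < 3) :
    ∃ (ι : Type) (_ : Fintype ι) (lam γ : ι → ℝ) (lo hi : ι → ℕ),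
      (∀ i, 0 ≤ lam i) ∧ (∑ i, lam i = 1) ∧ (∀ i, 0 ≤ γ i ∧ γ i ≤ 1) ∧ (∀ i, lo i ≤ hi i) ∧ (∀ i, hi i ≤ 3 * k) ∧
      (∀ h, blobLaw [(k, g₁), (k, g₂), (k, g₃)] h = ∑ i, lam i * TP[lo i, hi i, γ i, h]) ∧
      (∀ i, 0 < lam i → (g₁ + g₂ + g₃) / 3 ≤ γ i ∧ (g₁ + g₂ + g₃) * k ≤ 2 * (lo i : ℝ) + ((hi i : ℝ) - lo i) * γ i) := by
  set s : ℝ := g₁ + g₂ + g₃ with hs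
  have hk0 : (0 : ℝ) < k := by exact_mod_cast hk
  have hl : ∀ p ∈ [((k : ℕ), g₁), (k, g₂), (k, g₃)], p.1 = k ∧ 0 ≤ p.2 ∧ p.2 ≤ 1 := by
    intro p hp
    simp only [List.mem_cons, List.mem_nil_iff, or_false] at hp
    rcases hp with rfl | rfl | rfl
    · exact ⟨rfl, h₁0, h₁1⟩
    · exact ⟨rfl, h₂0, h₂1⟩
    · exact ⟨rfl, h₃0, h₃1⟩
  have hT : blobTop [((k : ℕ), g₁), (k, g₂), (k, g₃)] = 3 * k := by simp only [blobTop]; ring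
  have hM : blobMean [((k : ℕ), g₁), (k, g₂), (k, g₃)] = s * k := by simp only [blobMean]; rw [hs]; ring
  rcases le_or_gt s 2 with hs2 | hs2
  · -- `s ≤ 2`: the only low atom is `0`
    obtain ⟨ι, hι, lam, γ, lo, hi, a0, a1, ag, alohi, ahi, aμ, aval⟩ :=
      heavy_blobLaw_of_mean_le_two k _ hl (by rw [hM]; positivity) (by rw [hM]; nlinarith)
    refine ⟨ι, hι, lam, γ, lo, hi, a0, a1, ag, alohi, fun i => hT ▸ ahi i, aμ, fun i hi0 => ?_⟩
    obtain ⟨b1, b2⟩ := aval i hi0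
    rw [hM, hT] at b1
    rw [hM] at b2
    refine ⟨?_, b2⟩
    have e : s * (k : ℝ) / ((3 * k : ℕ) : ℝ) = s / 3 := by
      push_cast; field_simp
    rwa [e] at b1
  · -- `s > 2`: reflection at the floor gate `s/3`
    have hμ0 : ∀ h, 0 ≤ blobLaw [((k : ℕ), g₁), (k, g₂), (k, g₃)] h := blobLaw_nonneg _ fun p hp => (hl p hp).2
    refine heavy_of_reflection (3 * k) (blobLaw [((k : ℕ), g₁), (k, g₂), (k, g₃)]) (s / 3) (s * k) (by positivity) (by linarith)
      hμ0 (fun h hh => blobLaw_eq_zero _ h (by rw [hT]; exact hh)) (by have h1 := sum_blobLaw [((k : ℕ), g₁), (k, g₂), (k, g₃)]; rwa [hT] at h1)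
      (by push_cast; nlinarith) ?_
    intro b hb
    have hk1 : (1 : ℝ) ≤ k := by exact_mod_cast hk
    have hx1 : 0 ≤ 1 - s / 3 := by linarith
    by_cases hb0 : b = 0
    · subst hb0
      rw [Nat.sub_zero, blobLaw_three_apply, blobLaw_three_apply]
      simp only [pointLaw_apply, if_true, if_neg (show (0 : ℕ) ≠ k by omega), if_neg (show (0 : ℕ) ≠ 2 * k by omega),
        if_neg (show (0 : ℕ) ≠ 3 * k by omega), if_neg (show 3 * k ≠ 0 by omega), if_neg (show 3 * k ≠ k by omega),
        if_neg (show 3 * k ≠ 2 * k by omega), mul_one, mul_zero, add_zero, zero_add]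
      have hz := threeGates_capacity_zero h₁1 h₂1 h₃1 hs2.le
      rw [← hs] at hz
      nlinarith
    by_cases hbk : b = k
    · subst hbk
      rw [show 3 * b - b = 2 * b by omega, blobLaw_three_apply, blobLaw_three_apply]
      simp only [pointLaw_apply, if_true, if_neg (show b ≠ 0 by omega), if_neg (show b ≠ 2 * b by omega), if_neg (show b ≠ 3 * b by omega),
        if_neg (show 2 * b ≠ 0 by omega), if_neg (show 2 * b ≠ b by omega), if_neg (show 2 * b ≠ 3 * b by omega),
        mul_one, mul_zero, add_zero, zero_add]
      have ho := threeGates_capacity_one h₁1 h₂1 h₃1 hs2.le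
      rw [← hs] at ho
      nlinarith
    · -- any other low atom carries no mass (`2b < s·k < 3k` rules out `2k`, `3k`)
      have hb2 : b ≠ 2 * k := by
        intro e; rw [e] at hb; push_cast at hb; nlinarith
      have hb3 : b ≠ 3 * k := by
        intro e; rw [e] at hb; push_cast at hb; nlinarith
      have hzero : blobLaw [((k : ℕ), g₁), (k, g₂), (k, g₃)] b = 0 := by
        rw [blobLaw_three_apply]
        simp only [pointLaw_apply, if_neg hb0, if_neg hbk, if_neg hb2, if_neg hb3, mul_zero, add_zero]
      rw [hzero, mul_zero]
      exact mul_nonneg hx1 (hμ0 _)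

/-- **hence DEC at every layer**: three blobs with arbitrary gates, at the average gate and the mean. [this work] -/
theorem decAtT_threeBlobs_gates (k : ℕ) (hk : 0 < k) {g₁ g₂ g₃ : ℝ} (h₁0 : 0 ≤ g₁) (h₁1 : g₁ ≤ 1) (h₂0 : 0 ≤ g₂) (h₂1 : g₂ ≤ 1)
    (h₃0 : 0 ≤ g₃) (h₃1 : g₃ ≤ 1) (hs0 : 0 < g₁ + g₂ + g₃) (hs3 : g₁ + g₂ + g₃ < 3) (j : ℕ) :
    DECAtT ((g₁ + g₂ + g₃) / 3) ((g₁ + g₂ + g₃) * k) j (3 * k) (blobLaw [(k, g₁), (k, g₂), (k, g₃)]) :=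
  decAtT_of_heavy _ _ _ _ (heavy_threeBlobs_gates k hk h₁0 h₁1 h₂0 h₂1 h₃0 h₃1 hs0 hs3) j

end LawDec
end Quant
end Summit.CriticalPhenomena.PercolationContinuityZ3.Theorems
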